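import Summits.BirchSwinnertonDyer.BirchSwinnertonDyer.Theorems.EisensteinPrimesBSDpOnCellCTelescopeK2RefinedControlStrictSet
import Summits.BirchSwinnertonDyer.BirchSwinnertonDyer.Theorems.EisensteinPrimesBSDpOnCellCTelescopeK2TwistedFixedAnnihilator
import Summits.BirchSwinnertonDyer.BirchSwinnertonDyer.Theorems.EisensteinPrimesBSDpOnCellCTelescopeK2ControlOfCoefficients
import Summits.BirchSwinnertonDyer.BirchSwinnertonDyer.Theorems.ErratumRoadFiveBigRepInvariants
import HarnessLib

/-!
# Crux 4 `BSDpOnCellC` (stmt-BirchSwinnertonDyer-19034), line `telescope`, leaf N2 `stub_weightTwoControl` (W2) / N3′: the cokernel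
# half of the weight control of `Sel^Σ_𝔮(K, M₂)` at `r = C c` WITHOUT THE INERTIA CLAUSE — at the ramified inertia indices the input is
# FROBENIUS DATA (an annihilating polynomial of `Frob_w` on `A^{I_w}/c`, `κ(Frob_w) = N_w ∈ ℕ`, `c`-roots inside `A^{I_w}`), and the
# resulting scalar is `s = C(p^a) · ∏_w P_w((1+T)^{N_w})` (helper, `--supports stmt-BirchSwinnertonDyer-19034 --as helper`; closes nothing)

Cell `bsd-eis`, width seat `bsd-line-x2-p2` (prover g19, 2026-08-29; D-0154 KEY row 5). THEOREMS ONLY: no definition, no named fact, no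
`sorry`, no instance, no notation. ASSEMBLY by name of this seat's p749947/K-file `…RefinedControlStrictSet` (refined control on the K2
strict set), p750160 `…TwistedFixedAnnihilator` (refined `hkill` at a ramified `w` from Frobenius data), p747667 `…GlobalDefectFinite` +
p747781 `…InertiaDefect` (the decomposition index `𝔮`: finite cotorsion ⇒ killed by `C(p^a)`), p747595 `…BigRepDivisible` (`hr`) and
`Rank1Residual.X11b.BigRep.bigRep_restrict_invariants_eq_top` (unramified inertia indices). Repair (R2) of memo #52 §3, cokernel side,
replacing the hypothesis (hinert) of `TelescopeK2ControlOfCoefficients.smul_mem_map_torsionInclH1_selmer_of_coefficients` (p748531).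

* **`smul_mem_map_torsionInclH1_selmer_of_frobeniusData`** — for `ρ : Γ_K → Aut_𝒪(A)`, `κ`, strict prime `𝔮`, `Σ`, `c ∈ 𝒪`, a finite set
  `S₀` of «ramified» primes: from (hroot)/(htor) on `A`, the open image + finite fixed `c`-torsion at `𝔮`, `κ ∘ localMap K (Sum.inr w) = 1`
  on the strict set (tree, the `ℤ_p`-extension is unramified at `w ∤ p`), triviality of `I_w` on `A` for `w ∉ S₀`, and for `w ∈ S₀` Frobenius
  data `(d₀ w, N w, P w)` with `P w (ρ(res d₀ w))` killing `A^{I_w}/c·A^{I_w}` and `c`-roots inside `A^{I_w}`: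
  `∃ a, ∀ y ∈ Sel, (C c) • y = 0 → (C (p^a) * ∏_{w ∈ S₀} aeval ((1+X)^{N w}) (P w)) • y ∈ H¹(ι)(Sel(M₂[C c]))`.
* **`exists_quotSMulTop_XBig_linearMap_of_frobeniusData`** — the dual `∃ α : X^Σ_𝔮/(C c) →ₗ Sel(M₂[C c])^∨` form (kernel killed
  prime to `C c`, finite cokernel), adding (hfinK) for the kernel side (p748531 §1) and `C c ∤ C(p^a)·∏ P_w((1+T)^{N_w})`; via p743483.

HONEST FRAMING: assembly over binders; the arithmetic content of the Frobenius data on Cell C (annihilating polynomial via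
`A₂^{I_w}/X ↪ H¹(I_w, E[p^∞])` + Cayley–Hamilton; finite decomposition of `w ∣ N` in `K_∞`) is NOT proved here; nothing about any curve is
asserted; BSD is proved for no pair; no registered stub, crux or summit statement is proved by this file; closes: none.

References: [JetchevSkinnerWan2017] §3.4, Lemma 3.4.1 (arXiv:1512.06894 p. 14); [GreenbergVatsal2000] Prop. 2.4; [Ochiai2006] Prop. 5.1
(Compositio 142 p. 1177); [Castella2018Erratum] Lemma 2.1 (p. 2).
-/

noncomputable section

-- D-0017: single-problem summit, the namespace repeats the problem name by design.
set_option linter.dupNamespace false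
set_option autoImplicit false

open scoped Pointwise
open Polynomial hiding X C
open Field IsDedekindDomain NumberField
open Literature.NumberTheory.GaloisRepresentations Literature.NumberTheory.EllipticCurves
  Literature.NumberTheory.EllipticCurves.BigRepModule
open Literature.NumberTheory.EllipticCurves.BigGaloisRep (localMap strictSet LocalIndex LocalGroup inertiaIncl selmerBig XBig
  inl_mem_strictSet_iff)
open Summit.BirchSwinnertonDyer.Rank1Residual.X11b

universe u

namespace Summit.BirchSwinnertonDyer.BirchSwinnertonDyer.Theorems.TelescopeK2ControlOfFrobeniusData

variable {K : Type u} [Field K] [NumberField K] {p : ℕ} [Fact p.Prime]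
  {𝒪 : Type*} [CommRing 𝒪] [TopologicalSpace 𝒪]
  {A : Type u} [AddCommGroup A] [Module 𝒪 A] [TopologicalSpace A] [DiscreteTopology A]
  [TopologicalSpace (PowerSeries 𝒪)] [ContinuousSMul (PowerSeries 𝒪) (BigRepModule 𝒪 p A)]
  (κ : ZpExtension K p) (ρ : ContinuousRep (absoluteGaloisGroup K) 𝒪 A)

/-- **The cokernel half of the weight control on `strictSet p 𝔮 Σ` from FROBENIUS DATA at the ramified primes** (no inertia clause). See the
module docstring for the hypotheses; the scalar is `s = C (p^a) * ∏_{w ∈ S₀} aeval ((1+X)^{N w}) (P w)`.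
[cite: JetchevSkinnerWan2017, §3.4, Lemma 3.4.1 (arXiv:1512.06894 p. 14)] [cite: GreenbergVatsal2000, Prop. 2.4]
[cite: Ochiai2006, Prop. 5.1 (Compositio 142 p. 1177)] [cite: Castella2018Erratum, Lemma 2.1 (p. 2)] -/
theorem smul_mem_map_torsionInclH1_selmer_of_frobeniusData (𝔮 : HeightOneSpectrum (𝓞 K))
    (Sig : Set (HeightOneSpectrum (𝓞 K))) (c : 𝒪)
    (htor : ∀ a : A, (∃ k : ℕ, p ^ k • a = 0) → ∃ n : ℕ, c ^ n • a = 0)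
    (hroot : ∀ a : A, (∃ k : ℕ, p ^ k • a = 0) → ∃ b : A, (∃ k : ℕ, p ^ k • b = 0) ∧ c • b = a)
    {s𝔮 : ℕ} (hsurj𝔮 : ∀ y : ℤ_[p], ∃ τ : LocalGroup K (Sum.inl 𝔮),
      (κ (localMap K (Sum.inl 𝔮) τ)).toAdd = (p : ℤ_[p]) ^ s𝔮 * y)
    (hfin𝔮 : Set.Finite {a : A | c • a = 0 ∧ ∀ τ : LocalGroup K (Sum.inl 𝔮),
      κ (localMap K (Sum.inl 𝔮) τ) = 1 → ρ (localMap K (Sum.inl 𝔮) τ) a = a})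
    (S₀ : Finset (HeightOneSpectrum (𝓞 K)))
    (hunr : ∀ w : HeightOneSpectrum (𝓞 K), w ∉ S₀ → (Sum.inr w : LocalIndex K) ∈ strictSet p 𝔮 Sig →
      ∀ (τ : LocalGroup K (Sum.inr w)) (a : A), ρ (localMap K (Sum.inr w) τ) a = a)
    (d₀ : ∀ w : HeightOneSpectrum (𝓞 K), LocalGroup K (Sum.inl w)) (N : HeightOneSpectrum (𝓞 K) → ℕ)
    (hN : ∀ w ∈ S₀, (κ (localMap K (Sum.inl w) (d₀ w))).toAdd = (N w : ℤ_[p]))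
    (P : HeightOneSpectrum (𝓞 K) → 𝒪[X])
    (hP : ∀ w ∈ S₀, ∀ a : A, (∀ h : LocalGroup K (Sum.inr w), ρ (localMap K (Sum.inr w) h) a = a) →
      ∃ a₀ : A, (∀ h : LocalGroup K (Sum.inr w), ρ (localMap K (Sum.inr w) h) a₀ = a₀) ∧
        c • a₀ = (Polynomial.aeval (ρ (localMap K (Sum.inl w) (d₀ w))) (P w)) a)
    (hrootsI : ∀ w ∈ S₀, ∀ a : A, (∀ h : LocalGroup K (Sum.inr w), ρ (localMap K (Sum.inr w) h) a = a) →
      (∃ k : ℕ, p ^ k • a = 0) →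
      (∃ a₀ : A, (∀ h : LocalGroup K (Sum.inr w), ρ (localMap K (Sum.inr w) h) a₀ = a₀) ∧ c • a₀ = a) →
      ∃ b : A, (∀ h : LocalGroup K (Sum.inr w), ρ (localMap K (Sum.inr w) h) b = b) ∧ (∃ k : ℕ, p ^ k • b = 0) ∧ c • b = a) :
    ∃ a : ℕ, ∀ y : continuousCohomology 1 (AnticyclotomicBigGaloisRep κ ρ).toTopRep,
      y ∈ TorsionControl.selmer (localMap K) (strictSet p 𝔮 Sig) (AnticyclotomicBigGaloisRep κ ρ) →
      (PowerSeries.C c : PowerSeries 𝒪) • y = 0 →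
        ((PowerSeries.C ((p : 𝒪) ^ a) : PowerSeries 𝒪) *
            ∏ w ∈ S₀, (Polynomial.aeval (((1 : PowerSeries 𝒪) + PowerSeries.X) ^ (N w)) (P w) : PowerSeries 𝒪)) • y ∈
          Submodule.map (TorsionControl.torsionInclH1 (AnticyclotomicBigGaloisRep κ ρ) (PowerSeries.C c : PowerSeries 𝒪))
            (TorsionControl.selmer (localMap K) (strictSet p 𝔮 Sig)
              (TorsionControl.torsionRep (AnticyclotomicBigGaloisRep κ ρ) (PowerSeries.C c : PowerSeries 𝒪))) := by
  classical
  -- `hr`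
  have hr := TelescopeK2BigRepDivisible.C_smul_surjective_of_primaryRoots (p := p) c hroot
  -- the decomposition index: finite cotorsion, killed by one `C (p^a)`
  haveI hfin := TelescopeK2GlobalDefectFinite.finite_quotSMulTop_invariants_restrict κ.toContinuousMonoidHom ρ c
    (localMap K (Sum.inl 𝔮)) hsurj𝔮 htor hfin𝔮
  obtain ⟨a, ha⟩ := TelescopeK2InertiaDefect.exists_C_pow_smul_mem_of_finite_quotSMulTop (p := p)
    (((AnticyclotomicBigGaloisRep κ ρ).restrict (localMap K (Sum.inl 𝔮))).toTopRep).ρ.invariants c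
  set sprod : PowerSeries 𝒪 := ∏ w ∈ S₀, (Polynomial.aeval (((1 : PowerSeries 𝒪) + PowerSeries.X) ^ (N w)) (P w) : PowerSeries 𝒪)
    with hsprod
  refine ⟨a, fun y hy hyc => ?_⟩
  refine TelescopeK2RefinedControlStrictSet.smul_mem_map_torsionInclH1_selmer_strictSet_refined
    (AnticyclotomicBigGaloisRep κ ρ) 𝔮 Sig (PowerSeries.C c : PowerSeries 𝒪) _ hr ?_ ?_ hy hyc
  · -- `Sum.inl w`: `w = 𝔮`, finite cotorsion
    intro w hw m hm
    have hw𝔮 : w = 𝔮 := (inl_mem_strictSet_iff p 𝔮 w Sig).1 hw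
    subst hw𝔮
    obtain ⟨m', hm', h⟩ := ha m hm
    refine ⟨sprod • m', Submodule.smul_mem _ _ hm', ?_⟩
    rw [smul_comm, h, ← mul_smul, mul_comm]
  · -- `Sum.inr w`: unramified ⇒ everything is invariant; ramified ⇒ Frobenius data (p750160)
    intro w hw m hm hD
    have hκ : ∀ τ : LocalGroup K (Sum.inr w), κ.toContinuousMonoidHom (localMap K (Sum.inr w) τ) = 1 :=
      fun τ => ZpExtension.apply_localMap_eq_one_of_inr_mem_strictSet κ 𝔮 Sig hw τ
    by_cases hwS : w ∈ S₀
    · -- ramified: the refined `hkill` from the annihilating polynomial, then scale to the full scalar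
      have hNn : (absInertia (w.adicCompletion K)).Normal := absInertia_normal_holds (w.adicCompletion K)
      let g₀ : absoluteGaloisGroup (w.adicCompletion K) := d₀ w
      obtain ⟨m', hm', h⟩ := TelescopeK2TwistedFixedAnnihilator.exists_C_smul_eq_aeval_smul_invariants_restrict (p := p)
        κ.toContinuousMonoidHom ρ (localMap K (Sum.inr w)) hκ (localMap K (Sum.inl w) g₀)
        (fun (h : ↥(absInertia (w.adicCompletion K))) =>
          ⟨⟨g₀⁻¹ * (h : absoluteGaloisGroup (w.adicCompletion K)) * g₀, by
            have := hNn.conj_mem _ h.2 g₀⁻¹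
            simpa using this⟩, by
            change absGaloisRestrict K (w.adicCompletion K) (g₀⁻¹ * (h : absoluteGaloisGroup (w.adicCompletion K)) * g₀) =
              (absGaloisRestrict K (w.adicCompletion K) g₀)⁻¹ *
                absGaloisRestrict K (w.adicCompletion K) (h : absoluteGaloisGroup (w.adicCompletion K)) *
                absGaloisRestrict K (w.adicCompletion K) g₀
            rw [map_mul, map_mul, map_inv]⟩)
        (hN w hwS) c (P w) (hP w hwS) (hrootsI w hwS) m hm (hD g₀)
      refine ⟨(PowerSeries.C ((p : 𝒪) ^ a) * ∏ w' ∈ S₀.erase w,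
          (Polynomial.aeval (((1 : PowerSeries 𝒪) + PowerSeries.X) ^ (N w')) (P w') : PowerSeries 𝒪)) • m',
        Submodule.smul_mem _ _ hm', ?_⟩
      rw [smul_comm, h, ← mul_smul, hsprod, ← Finset.mul_prod_erase S₀ _ hwS]
      congr 1
      ring
    · -- unramified: `I_w` acts trivially, all of `M` is invariant; `C c` is onto
      have htriv : ∀ (τ : LocalGroup K (Sum.inr w)) (b : A), ρ (localMap K (Sum.inr w) τ) b = b := hunr w hwS hw
      obtain ⟨m', hm'⟩ := hr ((PowerSeries.C ((p : 𝒪) ^ a) * sprod) • m)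
      refine ⟨m', ?_, hm'⟩
      have htop := Rank1Residual.X11b.BigRep.bigRep_restrict_invariants_eq_top (p := p) κ.toContinuousMonoidHom ρ
        (localMap K (Sum.inr w)) hκ htriv
      change m' ∈ ((bigRep (p := p) κ.toContinuousMonoidHom ρ).restrict (localMap K (Sum.inr w))).toTopRep.ρ.invariants
      rw [htop]
      exact Submodule.mem_top

/-- **The `∃ α` control shape of W2 from Frobenius data** (dual form of `smul_mem_map_torsionInclH1_selmer_of_frobeniusData`,
replacing (hinert) of `TelescopeK2ControlOfCoefficients.exists_quotSMulTop_XBig_linearMap_of_coefficients`, p748531 §3): under the same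
hypotheses plus the global finite fixed `c`-torsion (hfinK, kernel side) and `C c ∤ C(p^a) · ∏_{w ∈ S₀} P_w((1+T)^{N_w})` for every `a`, there is
a `Λ`-linear `α : X^Σ_𝔮 / (C c) → Sel(M₂[C c])^∨` whose kernel is killed by elements prime to `C c` and whose cokernel is finite (p743483).
Nothing about any curve is asserted; closes nothing.
[cite: JetchevSkinnerWan2017, §3.4, Lemma 3.4.1 (arXiv:1512.06894 p. 14)] [cite: GreenbergVatsal2000, Prop. 2.4]
[cite: Ochiai2006, Prop. 5.1 (Compositio 142 p. 1177)] [cite: Castella2018Erratum, Lemma 2.1 (p. 2)] -/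
theorem exists_quotSMulTop_XBig_linearMap_of_frobeniusData (𝔮 : HeightOneSpectrum (𝓞 K))
    (Sig : Set (HeightOneSpectrum (𝓞 K))) (c : 𝒪)
    (htor : ∀ a : A, (∃ k : ℕ, p ^ k • a = 0) → ∃ n : ℕ, c ^ n • a = 0)
    (hroot : ∀ a : A, (∃ k : ℕ, p ^ k • a = 0) → ∃ b : A, (∃ k : ℕ, p ^ k • b = 0) ∧ c • b = a)
    (hfinK : Set.Finite {a : A | c • a = 0 ∧ ∀ g : absoluteGaloisGroup K, κ g = 1 → ρ g a = a})
    {s𝔮 : ℕ} (hsurj𝔮 : ∀ y : ℤ_[p], ∃ τ : LocalGroup K (Sum.inl 𝔮),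
      (κ (localMap K (Sum.inl 𝔮) τ)).toAdd = (p : ℤ_[p]) ^ s𝔮 * y)
    (hfin𝔮 : Set.Finite {a : A | c • a = 0 ∧ ∀ τ : LocalGroup K (Sum.inl 𝔮),
      κ (localMap K (Sum.inl 𝔮) τ) = 1 → ρ (localMap K (Sum.inl 𝔮) τ) a = a})
    (S₀ : Finset (HeightOneSpectrum (𝓞 K)))
    (hunr : ∀ w : HeightOneSpectrum (𝓞 K), w ∉ S₀ → (Sum.inr w : LocalIndex K) ∈ strictSet p 𝔮 Sig →
      ∀ (τ : LocalGroup K (Sum.inr w)) (a : A), ρ (localMap K (Sum.inr w) τ) a = a)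
    (d₀ : ∀ w : HeightOneSpectrum (𝓞 K), LocalGroup K (Sum.inl w)) (N : HeightOneSpectrum (𝓞 K) → ℕ)
    (hN : ∀ w ∈ S₀, (κ (localMap K (Sum.inl w) (d₀ w))).toAdd = (N w : ℤ_[p]))
    (P : HeightOneSpectrum (𝓞 K) → 𝒪[X])
    (hP : ∀ w ∈ S₀, ∀ a : A, (∀ h : LocalGroup K (Sum.inr w), ρ (localMap K (Sum.inr w) h) a = a) →
      ∃ a₀ : A, (∀ h : LocalGroup K (Sum.inr w), ρ (localMap K (Sum.inr w) h) a₀ = a₀) ∧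
        c • a₀ = (Polynomial.aeval (ρ (localMap K (Sum.inl w) (d₀ w))) (P w)) a)
    (hrootsI : ∀ w ∈ S₀, ∀ a : A, (∀ h : LocalGroup K (Sum.inr w), ρ (localMap K (Sum.inr w) h) a = a) →
      (∃ k : ℕ, p ^ k • a = 0) →
      (∃ a₀ : A, (∀ h : LocalGroup K (Sum.inr w), ρ (localMap K (Sum.inr w) h) a₀ = a₀) ∧ c • a₀ = a) →
      ∃ b : A, (∀ h : LocalGroup K (Sum.inr w), ρ (localMap K (Sum.inr w) h) b = b) ∧ (∃ k : ℕ, p ^ k • b = 0) ∧ c • b = a)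
    (hnd : ∀ a : ℕ, ¬ ((PowerSeries.C c : PowerSeries 𝒪) ∣
      (PowerSeries.C ((p : 𝒪) ^ a) : PowerSeries 𝒪) *
        ∏ w ∈ S₀, (Polynomial.aeval (((1 : PowerSeries 𝒪) + PowerSeries.X) ^ (N w)) (P w) : PowerSeries 𝒪))) :
    ∃ α : QuotSMulTop (PowerSeries.C c : PowerSeries 𝒪) (XBig κ ρ 𝔮 Sig) →ₗ[PowerSeries 𝒪]
        CharacterModule (TorsionControl.selmer (localMap K) (strictSet p 𝔮 Sig)
          (TorsionControl.torsionRep (AnticyclotomicBigGaloisRep κ ρ) (PowerSeries.C c : PowerSeries 𝒪))),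
      (∀ m ∈ LinearMap.ker α, ∃ t : PowerSeries 𝒪, ¬ ((PowerSeries.C c : PowerSeries 𝒪) ∣ t) ∧ t • m = 0) ∧
      Finite (CharacterModule (TorsionControl.selmer (localMap K) (strictSet p 𝔮 Sig)
          (TorsionControl.torsionRep (AnticyclotomicBigGaloisRep κ ρ) (PowerSeries.C c : PowerSeries 𝒪))) ⧸
        LinearMap.range α) := by
  obtain ⟨a, ha⟩ := smul_mem_map_torsionInclH1_selmer_of_frobeniusData κ ρ 𝔮 Sig c htor hroot hsurj𝔮 hfin𝔮 S₀ hunr d₀ N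
    hN P hP hrootsI
  -- the control map `θ : Sel(M₂[C c]) → Sel(M₂) = selmerBig`
  have hmaps : ∀ x ∈ TorsionControl.selmer (localMap K) (strictSet p 𝔮 Sig)
      (TorsionControl.torsionRep (AnticyclotomicBigGaloisRep κ ρ) (PowerSeries.C c : PowerSeries 𝒪)),
      TorsionControl.torsionInclH1 (AnticyclotomicBigGaloisRep κ ρ) (PowerSeries.C c : PowerSeries 𝒪) x ∈
        selmerBig κ ρ 𝔮 Sig :=
    fun x hx => TelescopeK2SelmerTorsionDefect.torsionInclH1_mem_selmer (localMap K) (strictSet p 𝔮 Sig)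
      (AnticyclotomicBigGaloisRep κ ρ) (PowerSeries.C c : PowerSeries 𝒪) hx
  let θ := (TorsionControl.torsionInclH1 (AnticyclotomicBigGaloisRep κ ρ) (PowerSeries.C c : PowerSeries 𝒪)).restrict hmaps
  -- `(C c) • θ = 0`
  have hθr : ∀ n, (PowerSeries.C c : PowerSeries 𝒪) • θ n = 0 := fun n => by
    apply Subtype.ext
    change (PowerSeries.C c : PowerSeries 𝒪) •
      TorsionControl.torsionInclH1 (AnticyclotomicBigGaloisRep κ ρ) (PowerSeries.C c : PowerSeries 𝒪)
        (n : continuousCohomology 1 (TorsionControl.torsionRep (AnticyclotomicBigGaloisRep κ ρ)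
          (PowerSeries.C c : PowerSeries 𝒪)).toTopRep) = 0
    rw [TorsionControl.torsionInclH1_apply]
    exact TorsionControl.smul_cohomologyMap_torsionIncl _ _ _
  -- finite kernel (p748531 §1)
  have hker : Finite (LinearMap.ker θ) := by
    haveI := TelescopeK2ControlOfCoefficients.finite_ker_torsionInclH1_of_coefficients κ ρ c htor hroot hfinK
    rw [LinearMap.ker_restrict]
    refine Finite.of_injective (fun x : Submodule.comap (Submodule.subtype _)
        (LinearMap.ker (TorsionControl.torsionInclH1 (AnticyclotomicBigGaloisRep κ ρ) (PowerSeries.C c : PowerSeries 𝒪))) =>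
      (⟨((x : TorsionControl.selmer (localMap K) (strictSet p 𝔮 Sig)
          (TorsionControl.torsionRep (AnticyclotomicBigGaloisRep κ ρ) (PowerSeries.C c : PowerSeries 𝒪))) :
            continuousCohomology 1 (TorsionControl.torsionRep (AnticyclotomicBigGaloisRep κ ρ)
              (PowerSeries.C c : PowerSeries 𝒪)).toTopRep), x.2⟩ :
        LinearMap.ker (TorsionControl.torsionInclH1 (AnticyclotomicBigGaloisRep κ ρ) (PowerSeries.C c : PowerSeries 𝒪)))) ?_
    intro x y hxy
    apply Subtype.ext
    apply Subtype.ext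
    exact congrArg (fun z : LinearMap.ker (TorsionControl.torsionInclH1 (AnticyclotomicBigGaloisRep κ ρ)
      (PowerSeries.C c : PowerSeries 𝒪)) => (z : continuousCohomology 1 (TorsionControl.torsionRep
        (AnticyclotomicBigGaloisRep κ ρ) (PowerSeries.C c : PowerSeries 𝒪)).toTopRep)) hxy
  -- `s • Sel(M₂)[C c] ⊆ range θ`, `s = C(p^a) · ∏ P_w((1+T)^{N_w})`
  have hs : ∀ y : selmerBig κ ρ 𝔮 Sig, (PowerSeries.C c : PowerSeries 𝒪) • y = 0 →
      ((PowerSeries.C ((p : 𝒪) ^ a) : PowerSeries 𝒪) *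
          ∏ w ∈ S₀, (Polynomial.aeval (((1 : PowerSeries 𝒪) + PowerSeries.X) ^ (N w)) (P w) : PowerSeries 𝒪)) • y ∈
        LinearMap.range θ := by
    intro y hyc
    have hyc' : (PowerSeries.C c : PowerSeries 𝒪) • (y : continuousCohomology 1 (AnticyclotomicBigGaloisRep κ ρ).toTopRep) = 0 := by
      rw [← Submodule.coe_smul, hyc, Submodule.coe_zero]
    obtain ⟨x, hxS, hxy⟩ := Submodule.mem_map.1 (ha y y.2 hyc')
    refine ⟨⟨x, hxS⟩, Subtype.ext ?_⟩
    rw [LinearMap.restrict_apply, Submodule.coe_smul]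
    exact hxy
  obtain ⟨f, -, hkerf, hcok⟩ :=
    TelescopeK2ControlTorsionDefect.exists_quotSMulTop_linearMap_torsionDefect_of_not_dvd
      (PowerSeries.C c : PowerSeries 𝒪) _ θ hθr hker hs (hnd a)
  exact ⟨f, hkerf, hcok⟩

end Summit.BirchSwinnertonDyer.BirchSwinnertonDyer.Theorems.TelescopeK2ControlOfFrobeniusData

end
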